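import Summits.AnomalousDissipation.AnomalousDissipation.Theorems.SawtoothPulseCascadeApproxDuhamel
import Literature.Analysis.FluidPDE.SawtoothCascadeK2Classical
import Literature.Analysis.FunctionSpaces.TorusInverseLaplacianL2

/-!
# The realigned pieces: comb data, zero mean, and the K2″ cap
(route `AnomalousDissipation/SawtoothPulseCascade`; helper for the crux ApproxSol58 =
stmt-AnomalousDissipation-19688, registered stub `stub_responseL2` / S1 `stub_responseL2Envelope`:
the realignment pipeline, K2″ consumption)

* §1 the realigned comb profile `g` of `…ApproxRealign` (smooth, `1`-periodic, coefficients supported on the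
  odd multiples of `N_j`) gives a K2″ datum: `ShearCombDatum (P.N j) hz (g(x_⊥) e_∥)`, with zero mean and
  `∫‖g(x_⊥) e_∥‖² ≤ (sup |g|)²`;
* §2 K2″ (`K2PhaseGrowthClassical P C`, at a fixed admissible `ν`) caps each realigned piece:
  `√∫‖W_i(t)‖² ≤ (C e^{σ⋆γ})^{J+1−j₀} · G` on phase `J ≥ j₀` for a piece injected at `tInject j₀ hz` with
  `|datum| ≤ G`;
* §3 the phase envelope: on slot `k` (phase `k/2 ≤ J`, `tStart (k/2 + 1) ≤ T'`),
  `√∫‖L(t)‖² ≤ Σ_{i<k} (C e^{σ⋆γ})^{k/2+1−i/2} G_i + 6√(2π) ν N_{k/2} γ/δ_{k/2}`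
  (`…ApproxDuhamel.response_slot_bound` + §2).
-/

set_option linter.dupNamespace false

noncomputable section

namespace Summit.AnomalousDissipation.AnomalousDissipation.Theorems.SawtoothPulseCascade.ApproxResponse

open Set MeasureTheory UnitAddTorus
open scoped ContDiff InnerProductSpace
open Literature.Analysis Literature.Analysis.FunctionSpaces Literature.Analysis.FluidPDE
open Literature.Analysis.FluidPDE.SawtoothCascade
open Literature.Analysis.FluidPDE.SawtoothCascade.CascadeParams
open Summit.AnomalousDissipation.AnomalousDissipation.Theorems.SawtoothPulseCascade.K2Classical

/-! ## §1 Comb profiles as K2″ data -/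

/-- A smooth `1`-periodic profile with coefficients on the odd multiples of `N`, laid horizontally, is a
`ShearCombDatum N true`. -/
theorem shearCombDatum_of_comb_H {N : ℕ} {g : ℝ → ℝ} (hg : ContDiff ℝ ∞ g) (hper : Function.Periodic g 1)
    (hcomb : ∀ m : ℤ, (¬ ∃ n : ℤ, m = (2 * n + 1) * (N : ℤ)) →
      fourierCoeff (AddCircle.liftIco 1 0 fun y => (g y : ℂ)) m = 0) :
    ShearCombDatum N true (fun x : UnitAddTorus (Fin 2) => g (Torus.repr x 1) • EuclideanSpace.single (0 : Fin 2) (1 : ℝ)) :=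
  ⟨g, hg, hper, fun m hm => (fourierCoeff_liftIco_ofReal_eq_zero_iff hg.continuous m).1 (hcomb m hm),
    parallel_true_eq g⟩

/-- Vertical twin of `shearCombDatum_of_comb_H`. -/
theorem shearCombDatum_of_comb_V {N : ℕ} {g : ℝ → ℝ} (hg : ContDiff ℝ ∞ g) (hper : Function.Periodic g 1)
    (hcomb : ∀ m : ℤ, (¬ ∃ n : ℤ, m = (2 * n + 1) * (N : ℤ)) →
      fourierCoeff (AddCircle.liftIco 1 0 fun y => (g y : ℂ)) m = 0) :
    ShearCombDatum N false (fun x : UnitAddTorus (Fin 2) => g (Torus.repr x 0) • EuclideanSpace.single (1 : Fin 2) (1 : ℝ)) :=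
  ⟨g, hg, hper, fun m hm => (fourierCoeff_liftIco_ofReal_eq_zero_iff hg.continuous m).1 (hcomb m hm),
    parallel_false_eq g⟩

/-- `0` is not an odd multiple of `N ≠ 0`. -/
theorem zero_not_odd_mul {N : ℕ} (hN : N ≠ 0) : ¬ ∃ n : ℤ, (0 : ℤ) = (2 * n + 1) * (N : ℤ) := by
  rintro ⟨n, hn⟩
  have hN' : (N : ℤ) ≠ 0 := by exact_mod_cast hN
  have h2 : (2 * n + 1 : ℤ) ≠ 0 := by omega
  exact (mul_ne_zero h2 hN') hn.symm

/-- A comb profile integrates to zero over `𝕋²` along either coordinate. -/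
theorem integral_comb_coordFun {N : ℕ} (hN : N ≠ 0) {g : ℝ → ℝ} (hg : ContDiff ℝ ∞ g)
    (hper : Function.Periodic g 1)
    (hcomb : ∀ m : ℤ, (¬ ∃ n : ℤ, m = (2 * n + 1) * (N : ℤ)) →
      fourierCoeff (AddCircle.liftIco 1 0 fun y => (g y : ℂ)) m = 0) (i : Fin 2) :
    ∫ x : UnitAddTorus (Fin 2), g (Torus.repr x i) = 0 := by
  have hG : Continuous (AddCircle.liftIco 1 0 (fun y => (g y : ℂ))) :=
    continuous_liftIco_of_periodic (Complex.continuous_ofReal.comp hg.continuous) (fun y => by simp [hper y])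
  have h1 : mFourierCoeff (fun x : UnitAddTorus (Fin 2) => ((g (Torus.repr x i) : ℝ) : ℂ)) (Pi.single i 0) =
      fourierCoeff (AddCircle.liftIco 1 0 (fun y => (g y : ℂ))) 0 := by
    have hfun : (fun x : UnitAddTorus (Fin 2) => ((g (Torus.repr x i) : ℝ) : ℂ)) =
        fun x => AddCircle.liftIco 1 0 (fun y => (g y : ℂ)) (x i) := by
      funext x; rfl
    rw [hfun]
    exact Torus.mFourierCoeff_comp_eval_single (d := Fin 2) hG i 0
  rw [Pi.single_zero, Torus.mFourierCoeff_zero_eq_integral, hcomb 0 (zero_not_odd_mul hN),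
    integral_complex_ofReal] at h1
  exact_mod_cast h1

/-- Zero mean of the horizontal comb field. -/
theorem hasZeroMean_comb_H {N : ℕ} (hN : N ≠ 0) {g : ℝ → ℝ} (hg : ContDiff ℝ ∞ g) (hper : Function.Periodic g 1)
    (hcomb : ∀ m : ℤ, (¬ ∃ n : ℤ, m = (2 * n + 1) * (N : ℤ)) →
      fourierCoeff (AddCircle.liftIco 1 0 fun y => (g y : ℂ)) m = 0) :
    Torus.HasZeroMean (fun x : UnitAddTorus (Fin 2) => g (Torus.repr x 1) • EuclideanSpace.single (0 : Fin 2) (1 : ℝ)) := by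
  unfold Torus.HasZeroMean
  rw [integral_smul_const, integral_comb_coordFun hN hg hper hcomb 1, zero_smul]

/-- Zero mean of the vertical comb field. -/
theorem hasZeroMean_comb_V {N : ℕ} (hN : N ≠ 0) {g : ℝ → ℝ} (hg : ContDiff ℝ ∞ g) (hper : Function.Periodic g 1)
    (hcomb : ∀ m : ℤ, (¬ ∃ n : ℤ, m = (2 * n + 1) * (N : ℤ)) →
      fourierCoeff (AddCircle.liftIco 1 0 fun y => (g y : ℂ)) m = 0) :
    Torus.HasZeroMean (fun x : UnitAddTorus (Fin 2) => g (Torus.repr x 0) • EuclideanSpace.single (1 : Fin 2) (1 : ℝ)) := by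
  unfold Torus.HasZeroMean
  rw [integral_smul_const, integral_comb_coordFun hN hg hper hcomb 0, zero_smul]

/-- Size of a parallel profile field: `∫‖g(x_k) e_m‖² ≤ G²` when `|g| ≤ G`. -/
theorem vectorL2Sq_parallel_le {g : ℝ → ℝ} {G : ℝ} (hG : 0 ≤ G) (hg : ∀ y, |g y| ≤ G) (k m : Fin 2) :
    Torus.vectorL2Sq (fun x : UnitAddTorus (Fin 2) => g (Torus.repr x k) • EuclideanSpace.single m (1 : ℝ)) ≤ G ^ 2 := by
  have h := sqrt_vectorL2Sq_parallel_le hG hg k m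
  have h0 : 0 ≤ Torus.vectorL2Sq (fun x : UnitAddTorus (Fin 2) => g (Torus.repr x k) • EuclideanSpace.single m (1 : ℝ)) := by
    unfold Torus.vectorL2Sq; exact integral_nonneg fun x => by positivity
  calc Torus.vectorL2Sq (fun x : UnitAddTorus (Fin 2) => g (Torus.repr x k) • EuclideanSpace.single m (1 : ℝ))
      = Real.sqrt (Torus.vectorL2Sq (fun x : UnitAddTorus (Fin 2) => g (Torus.repr x k) • EuclideanSpace.single m (1 : ℝ))) ^ 2 :=
        (Real.sq_sqrt h0).symm
    _ ≤ G ^ 2 := pow_le_pow_left₀ (Real.sqrt_nonneg _) h 2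

/-! ## §2 The K2″ cap of one realigned piece -/

/-- **K2″ caps a realigned piece.**  Let the K2″ property hold at viscosity `ν` (the body of
`K2PhaseGrowthClassical P C` at `ν`), and let `(W, R)` be a classical homogeneous linearised solution on
`[tInject j₀ hz, T']` with a residual-comb datum `w₀` (`ShearCombDatum (P.N j₀) hz w₀`, `∫‖w₀‖² ≤ G²`).
Then on every phase `J ≥ j₀` with `tStart (J+1) ≤ T'`:
`√∫‖W(t)‖² ≤ (C e^{σ⋆γ})^{J+1−j₀} G` for `t ∈ [max (tInject j₀ hz) (tStart J), tStart (J+1)]`. -/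
theorem piece_bound (P : CascadeParams) {C ν T' G : ℝ} (hC : 0 ≤ C) (hG : 0 ≤ G)
    (hK2ν : ∀ (j₀ J : ℕ), j₀ ≤ J → ∀ (hz : Bool)
      (w₀ : UnitAddTorus (Fin 2) → EuclideanSpace ℝ (Fin 2))
      (w : ℝ → UnitAddTorus (Fin 2) → EuclideanSpace ℝ (Fin 2)) (q : ℝ → UnitAddTorus (Fin 2) → ℝ),
      ShearCombDatum (P.N j₀) hz w₀ →
      Torus.IsSmoothSpaceTimeOn (Icc (CascadeParams.tInject j₀ hz) (CascadeParams.tStart (J + 1))) w →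
      Torus.IsSmoothSpaceTimeOn (Icc (CascadeParams.tInject j₀ hz) (CascadeParams.tStart (J + 1))) q →
      (∀ t ∈ Icc (CascadeParams.tInject j₀ hz) (CascadeParams.tStart (J + 1)), Torus.IsDivFree (w t)) →
      (∀ t ∈ Icc (CascadeParams.tInject j₀ hz) (CascadeParams.tStart (J + 1)), ∀ x,
        Torus.timeDerivWithin (Icc (CascadeParams.tInject j₀ hz) (CascadeParams.tStart (J + 1))) w t x +
          Torus.convect (P.field t) (w t) x + Torus.convect (w t) (P.field t) x =
          ν • Torus.laplacian (w t) x - Torus.gradient (q t) x) →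
      w (CascadeParams.tInject j₀ hz) = w₀ →
      ∀ t ∈ Icc (max (CascadeParams.tInject j₀ hz) (CascadeParams.tStart J)) (CascadeParams.tStart (J + 1)),
        Torus.vectorL2Sq (w t) ≤ (C * Real.exp (sawSigmaStar * P.γ)) ^ (2 * (J + 1 - j₀)) * Torus.vectorL2Sq w₀)
    {j₀ : ℕ} {hz : Bool} {w₀ : UnitAddTorus (Fin 2) → EuclideanSpace ℝ (Fin 2)}
    (hdat : ShearCombDatum (P.N j₀) hz w₀) (hw₀ : Torus.vectorL2Sq w₀ ≤ G ^ 2)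
    {W : ℝ → UnitAddTorus (Fin 2) → EuclideanSpace ℝ (Fin 2)} {R : ℝ → UnitAddTorus (Fin 2) → ℝ}
    (hW : Torus.IsSmoothSpaceTimeOn (Icc (CascadeParams.tInject j₀ hz) T') W)
    (hR : Torus.IsSmoothSpaceTimeOn (Icc (CascadeParams.tInject j₀ hz) T') R)
    (hWdiv : ∀ t ∈ Icc (CascadeParams.tInject j₀ hz) T', Torus.IsDivFree (W t))
    (hWlin : ∀ t ∈ Icc (CascadeParams.tInject j₀ hz) T', ∀ x,
      Torus.timeDerivWithin (Icc (CascadeParams.tInject j₀ hz) T') W t x +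
        Torus.convect (P.field t) (W t) x + Torus.convect (W t) (P.field t) x =
          ν • Torus.laplacian (W t) x - Torus.gradient (R t) x)
    (hW0 : W (CascadeParams.tInject j₀ hz) = w₀)
    {J : ℕ} (hJ : j₀ ≤ J) (hJT : CascadeParams.tStart (J + 1) ≤ T')
    {t : ℝ} (ht : t ∈ Icc (max (CascadeParams.tInject j₀ hz) (CascadeParams.tStart J)) (CascadeParams.tStart (J + 1))) :
    Real.sqrt (Torus.vectorL2Sq (W t)) ≤ (C * Real.exp (sawSigmaStar * P.γ)) ^ (J + 1 - j₀) * G := by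
  have hlt : CascadeParams.tInject j₀ hz < CascadeParams.tStart (J + 1) :=
    (tInject_lt_tStart_succ j₀ hz).trans_le (tStart_strictMono.monotone (Nat.succ_le_succ hJ))
  have hsub : Icc (CascadeParams.tInject j₀ hz) (CascadeParams.tStart (J + 1)) ⊆ Icc (CascadeParams.tInject j₀ hz) T' :=
    Icc_subset_Icc le_rfl hJT
  have hlin' : ∀ s ∈ Icc (CascadeParams.tInject j₀ hz) (CascadeParams.tStart (J + 1)), ∀ x,
      Torus.timeDerivWithin (Icc (CascadeParams.tInject j₀ hz) (CascadeParams.tStart (J + 1))) W s x +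
        Torus.convect (P.field s) (W s) x + Torus.convect (W s) (P.field s) x =
          ν • Torus.laplacian (W s) x - Torus.gradient (R s) x := by
    intro s hs x
    rw [timeDerivWithin_Icc_eq_of_subset hlt hsub hW hs x]
    exact hWlin s (hsub hs) x
  have h := hK2ν j₀ J hJ hz w₀ W R hdat (hW.mono hsub) (hR.mono hsub) (fun s hs => hWdiv s (hsub hs)) hlin' hW0 t ht
  have hE : 0 ≤ C * Real.exp (sawSigmaStar * P.γ) := mul_nonneg hC (Real.exp_pos _).le
  have h2 : Torus.vectorL2Sq (W t) ≤ ((C * Real.exp (sawSigmaStar * P.γ)) ^ (J + 1 - j₀) * G) ^ 2 := by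
    calc Torus.vectorL2Sq (W t) ≤ (C * Real.exp (sawSigmaStar * P.γ)) ^ (2 * (J + 1 - j₀)) * Torus.vectorL2Sq w₀ := h
      _ ≤ (C * Real.exp (sawSigmaStar * P.γ)) ^ (2 * (J + 1 - j₀)) * G ^ 2 :=
          mul_le_mul_of_nonneg_left hw₀ (pow_nonneg hE _)
      _ = ((C * Real.exp (sawSigmaStar * P.γ)) ^ (J + 1 - j₀) * G) ^ 2 := by rw [pow_mul']; ring
  calc Real.sqrt (Torus.vectorL2Sq (W t)) ≤ Real.sqrt (((C * Real.exp (sawSigmaStar * P.γ)) ^ (J + 1 - j₀) * G) ^ 2) :=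
        Real.sqrt_le_sqrt h2
    _ = (C * Real.exp (sawSigmaStar * P.γ)) ^ (J + 1 - j₀) * G := Real.sqrt_sq (mul_nonneg (pow_nonneg hE _) hG)


/-! ## §3 The phase envelope -/

/-- Slot `k` lies in phase `k/2`: `tStart (k/2) ≤ σ k`. -/
theorem tStart_half_le_slotStart (k : ℕ) : tStart (k / 2) ≤ CascadeParams.tInject (k / 2) (k % 2 == 0) := by
  obtain ⟨j, rfl | rfl⟩ := Nat.even_or_odd' k
  · rw [slotStart_even, show 2 * j / 2 = j by omega]
  · rw [slotStart_odd, show (2 * j + 1) / 2 = j by omega]; linarith [tHalf_pos j]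

/-- Slot `k` lies in phase `k/2`: `σ (k+1) ≤ tStart (k/2 + 1)`. -/
theorem slotStart_succ_le_tStart (k : ℕ) :
    CascadeParams.tInject ((k + 1) / 2) ((k + 1) % 2 == 0) ≤ tStart (k / 2 + 1) := by
  obtain ⟨j, rfl | rfl⟩ := Nat.even_or_odd' k
  · rw [slotStart_even_succ, show 2 * j / 2 = j by omega, tStart_succ]; linarith [tHalf_pos j]
  · rw [slotStart_odd_succ, show (2 * j + 1) / 2 = j by omega]

section Envelope

variable (P : CascadeParams) {ν T' : ℝ} {K : ℕ}
  {W : ℕ → ℝ → UnitAddTorus (Fin 2) → EuclideanSpace ℝ (Fin 2)} {g : ℕ → ℝ → ℝ} {G : ℕ → ℝ}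

/-- The datum of piece `i` is a residual comb of frequency `N_{i/2}` of size `≤ G i`. -/
theorem piece_datum (hg : ∀ k < K, ContDiff ℝ ∞ (g k) ∧ Function.Periodic (g k) 1)
    (hcomb : ∀ k < K, ∀ m : ℤ, (¬ ∃ n : ℤ, m = (2 * n + 1) * (P.N (k / 2) : ℤ)) →
      fourierCoeff (AddCircle.liftIco 1 0 fun y => (g k y : ℂ)) m = 0)
    (hG0 : ∀ k, 0 ≤ G k) (hGk : ∀ k < K, ∀ y, |g k y| ≤ G k)
    (hW0H : ∀ j, 2 * j < K → W (2 * j) (tStart j) =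
      fun x => g (2 * j) (Torus.repr x 1) • EuclideanSpace.single (0 : Fin 2) (1 : ℝ))
    (hW0V : ∀ j, 2 * j + 1 < K → W (2 * j + 1) (tStart j + tHalf j) =
      fun x => g (2 * j + 1) (Torus.repr x 0) • EuclideanSpace.single (1 : Fin 2) (1 : ℝ))
    {i : ℕ} (hi : i < K) :
    ShearCombDatum (P.N (i / 2)) (i % 2 == 0) (W i (CascadeParams.tInject (i / 2) (i % 2 == 0))) ∧
      Torus.vectorL2Sq (W i (CascadeParams.tInject (i / 2) (i % 2 == 0))) ≤ G i ^ 2 := by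
  obtain ⟨j, rfl | rfl⟩ := Nat.even_or_odd' i
  · rw [slotStart_even, show 2 * j / 2 = j by omega, show (2 * j % 2 == 0) = true by simp, hW0H j hi]
    exact ⟨shearCombDatum_of_comb_H (hg _ hi).1 (hg _ hi).2 (by simpa [show 2 * j / 2 = j by omega] using hcomb _ hi),
      vectorL2Sq_parallel_le (hG0 _) (hGk _ hi) 1 0⟩
  · rw [slotStart_odd, show (2 * j + 1) / 2 = j by omega, show ((2 * j + 1) % 2 == 0) = false by simp, hW0V j hi]
    exact ⟨shearCombDatum_of_comb_V (hg _ hi).1 (hg _ hi).2 (by simpa [show (2 * j + 1) / 2 = j by omega] using hcomb _ hi),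
      vectorL2Sq_parallel_le (hG0 _) (hGk _ hi) 0 1⟩

/-- **The phase envelope of the forced response.**  Let the K2″ property hold at viscosity `ν` with
constant `C ≥ 0`, let `(L, q)` be the forced response on `[0, T']` from zero, `tStart (J+1) ≤ T'`, and let
the realigned comb profiles `g k` (`k < 2(J+1)`, sizes `|g k| ≤ G k`) and pieces `W k` be as in
`response_at_slotStart`.  Then for every slot `k < 2(J+1)` and `t` in it,
`√∫‖L(t)‖² ≤ Σ_{i<k} (C e^{σ⋆γ})^{k/2+1−i/2} G i + 6√(2π) ν N_{k/2} γ / δ_{k/2}`. -/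
theorem response_phase_envelope (hδ₀ : 0 < P.δ₀) (hd : 0 < P.d) (hγ : 0 ≤ P.γ) (hN : ∀ j, P.N j ≠ 0)
    (hν : 0 < ν) {C : ℝ} (hC : 0 ≤ C)
    (hK2ν : ∀ (j₀ J : ℕ), j₀ ≤ J → ∀ (hz : Bool)
      (w₀ : UnitAddTorus (Fin 2) → EuclideanSpace ℝ (Fin 2))
      (w : ℝ → UnitAddTorus (Fin 2) → EuclideanSpace ℝ (Fin 2)) (q : ℝ → UnitAddTorus (Fin 2) → ℝ),
      ShearCombDatum (P.N j₀) hz w₀ →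
      Torus.IsSmoothSpaceTimeOn (Icc (CascadeParams.tInject j₀ hz) (CascadeParams.tStart (J + 1))) w →
      Torus.IsSmoothSpaceTimeOn (Icc (CascadeParams.tInject j₀ hz) (CascadeParams.tStart (J + 1))) q →
      (∀ t ∈ Icc (CascadeParams.tInject j₀ hz) (CascadeParams.tStart (J + 1)), Torus.IsDivFree (w t)) →
      (∀ t ∈ Icc (CascadeParams.tInject j₀ hz) (CascadeParams.tStart (J + 1)), ∀ x,
        Torus.timeDerivWithin (Icc (CascadeParams.tInject j₀ hz) (CascadeParams.tStart (J + 1))) w t x +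
          Torus.convect (P.field t) (w t) x + Torus.convect (w t) (P.field t) x =
          ν • Torus.laplacian (w t) x - Torus.gradient (q t) x) →
      w (CascadeParams.tInject j₀ hz) = w₀ →
      ∀ t ∈ Icc (max (CascadeParams.tInject j₀ hz) (CascadeParams.tStart J)) (CascadeParams.tStart (J + 1)),
        Torus.vectorL2Sq (w t) ≤ (C * Real.exp (sawSigmaStar * P.γ)) ^ (2 * (J + 1 - j₀)) * Torus.vectorL2Sq w₀)
    {J : ℕ} (hJT : tStart (J + 1) ≤ T')
    {L : ℝ → UnitAddTorus (Fin 2) → EuclideanSpace ℝ (Fin 2)} {q : ℝ → UnitAddTorus (Fin 2) → ℝ}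
    (hL : Torus.IsSmoothSpaceTimeOn (Icc 0 T') L) (hq : Torus.IsSmoothSpaceTimeOn (Icc 0 T') q)
    (hLdiv : ∀ t ∈ Icc 0 T', Torus.IsDivFree (L t)) (hL0 : L 0 = fun _ => 0)
    (hlin : ∀ t ∈ Icc 0 T', ∀ x, Torus.timeDerivWithin (Icc 0 T') L t x + Torus.convect (P.field t) (L t) x +
      Torus.convect (L t) (P.field t) x =
        ν • Torus.laplacian (L t) x - Torus.gradient (q t) x + ν • Torus.laplacian (P.field t) x)
    (hg : ∀ k < 2 * (J + 1), ContDiff ℝ ∞ (g k) ∧ Function.Periodic (g k) 1)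
    (hcomb : ∀ k < 2 * (J + 1), ∀ m : ℤ, (¬ ∃ n : ℤ, m = (2 * n + 1) * (P.N (k / 2) : ℤ)) →
      fourierCoeff (AddCircle.liftIco 1 0 fun y => (g k y : ℂ)) m = 0)
    (hG0 : ∀ k, 0 ≤ G k) (hGk : ∀ k < 2 * (J + 1), ∀ y, |g k y| ≤ G k)
    (hrealH : ∀ j, 2 * j < 2 * (J + 1) → ∀ c F : ℝ → ℝ → ℝ,
        ContDiffOn ℝ ∞ (Function.uncurry c) (Icc (tStart j) (tStart j + tHalf j) ×ˢ univ) →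
        (∀ t ∈ Icc (tStart j) (tStart j + tHalf j), Function.Periodic (c t) 1) →
        (∀ t ∈ Icc (tStart j) (tStart j + tHalf j), ∀ y,
          derivWithin (fun s => c s y) (Icc (tStart j) (tStart j + tHalf j)) t = ν * deriv (deriv (c t)) y) →
        c (tStart j) = g (2 * j) →
        ContDiffOn ℝ ∞ (Function.uncurry F) (Icc (tStart j) (tStart j + tHalf j) ×ˢ univ) →
        (∀ t ∈ Icc (tStart j) (tStart j + tHalf j), Function.Periodic (F t) 1) → F (tStart j) = (fun _ => 0) →
        (∀ t ∈ Icc (tStart j) (tStart j + tHalf j), ∀ y,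
          derivWithin (fun s => F s y) (Icc (tStart j) (tStart j + tHalf j)) t =
            ν * deriv (deriv (F t)) y + ν * (P.rateH j t * deriv (deriv (P.U j)) y)) →
        c (tStart j + tHalf j) = F (tStart j + tHalf j))
    (hrealV : ∀ j, 2 * j + 1 < 2 * (J + 1) → ∀ c F : ℝ → ℝ → ℝ,
        ContDiffOn ℝ ∞ (Function.uncurry c) (Icc (tStart j + tHalf j) (tStart (j + 1)) ×ˢ univ) →
        (∀ t ∈ Icc (tStart j + tHalf j) (tStart (j + 1)), Function.Periodic (c t) 1) →
        (∀ t ∈ Icc (tStart j + tHalf j) (tStart (j + 1)), ∀ y,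
          derivWithin (fun s => c s y) (Icc (tStart j + tHalf j) (tStart (j + 1))) t = ν * deriv (deriv (c t)) y) →
        c (tStart j + tHalf j) = g (2 * j + 1) →
        ContDiffOn ℝ ∞ (Function.uncurry F) (Icc (tStart j + tHalf j) (tStart (j + 1)) ×ˢ univ) →
        (∀ t ∈ Icc (tStart j + tHalf j) (tStart (j + 1)), Function.Periodic (F t) 1) →
        F (tStart j + tHalf j) = (fun _ => 0) →
        (∀ t ∈ Icc (tStart j + tHalf j) (tStart (j + 1)), ∀ y,
          derivWithin (fun s => F s y) (Icc (tStart j + tHalf j) (tStart (j + 1))) t =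
            ν * deriv (deriv (F t)) y + ν * (P.rateV j t * deriv (deriv (P.U j)) y)) →
        c (tStart (j + 1)) = F (tStart (j + 1)))
    {R : ℕ → ℝ → UnitAddTorus (Fin 2) → ℝ}
    (hW : ∀ i < 2 * (J + 1), Torus.IsSmoothSpaceTimeOn (Icc (CascadeParams.tInject (i / 2) (i % 2 == 0)) T') (W i))
    (hR : ∀ i < 2 * (J + 1), Torus.IsSmoothSpaceTimeOn (Icc (CascadeParams.tInject (i / 2) (i % 2 == 0)) T') (R i))
    (hWdiv : ∀ i < 2 * (J + 1), ∀ t ∈ Icc (CascadeParams.tInject (i / 2) (i % 2 == 0)) T', Torus.IsDivFree (W i t))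
    (hWlin : ∀ i < 2 * (J + 1), ∀ t ∈ Icc (CascadeParams.tInject (i / 2) (i % 2 == 0)) T', ∀ x,
      Torus.timeDerivWithin (Icc (CascadeParams.tInject (i / 2) (i % 2 == 0)) T') (W i) t x +
        Torus.convect (P.field t) (W i t) x + Torus.convect (W i t) (P.field t) x =
          ν • Torus.laplacian (W i t) x - Torus.gradient (R i t) x)
    (hW0H : ∀ j, 2 * j < 2 * (J + 1) → W (2 * j) (tStart j) =
      fun x => g (2 * j) (Torus.repr x 1) • EuclideanSpace.single (0 : Fin 2) (1 : ℝ))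
    (hW0V : ∀ j, 2 * j + 1 < 2 * (J + 1) → W (2 * j + 1) (tStart j + tHalf j) =
      fun x => g (2 * j + 1) (Torus.repr x 0) • EuclideanSpace.single (1 : Fin 2) (1 : ℝ))
    {k : ℕ} (hk : k < 2 * (J + 1)) {t : ℝ}
    (ht : t ∈ Icc (CascadeParams.tInject (k / 2) (k % 2 == 0)) (CascadeParams.tInject ((k + 1) / 2) ((k + 1) % 2 == 0))) :
    Real.sqrt (Torus.vectorL2Sq (L t)) ≤
      ∑ i ∈ Finset.range k, (C * Real.exp (sawSigmaStar * P.γ)) ^ (k / 2 + 1 - i / 2) * G i +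
        6 * Real.sqrt (2 * Real.pi) * ν * (P.N (k / 2)) * P.γ / P.δ (k / 2) := by
  have hK : CascadeParams.tInject (2 * (J + 1) / 2) (2 * (J + 1) % 2 == 0) ≤ T' := by
    rw [slotStart_even (J + 1)]; exact hJT
  have hslot := response_slot_bound P hδ₀ hd hγ hN hν hK hL hq hLdiv hL0 hlin hg hrealH hrealV hW hR hWdiv hWlin
    hW0H hW0V hk ht
  refine hslot.trans (add_le_add (Finset.sum_le_sum fun i hi => ?_) le_rfl)
  have hi' : i < k := Finset.mem_range.1 hi
  have hiK : i < 2 * (J + 1) := hi'.trans hk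
  obtain ⟨hdat, hsize⟩ := piece_datum P hg hcomb hG0 hGk hW0H hW0V hiK
  -- phase of slot `k`
  have hkJ : k / 2 ≤ J := by omega
  have hJ'T : tStart (k / 2 + 1) ≤ T' := (tStart_strictMono.monotone (Nat.succ_le_succ hkJ)).trans hJT
  have hij : i / 2 ≤ k / 2 := Nat.div_le_div_right hi'.le
  have htK2 : t ∈ Icc (max (CascadeParams.tInject (i / 2) (i % 2 == 0)) (tStart (k / 2))) (tStart (k / 2 + 1)) := by
    refine ⟨max_le ((slotStart_mono hi'.le).trans ht.1) ((tStart_half_le_slotStart k).trans ht.1), ?_⟩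
    exact ht.2.trans (slotStart_succ_le_tStart k)
  exact piece_bound P hC (hG0 i) hK2ν hdat hsize (hW i hiK) (hR i hiK) (hWdiv i hiK) (hWlin i hiK) rfl hij hJ'T htK2


end Envelope

end Summit.AnomalousDissipation.AnomalousDissipation.Theorems.SawtoothPulseCascade.ApproxResponse

end
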